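import Summits.NavierStokesRegularity.NavierStokesRegularity.Theses.TypeIIInviscidRelaxation
import Summits.NavierStokesRegularity.NavierStokesRegularity.Theorems.TypeIIInviscidRelaxationAxisymSwirlRegularZhangBarrier
import Summits.NavierStokesRegularity.NavierStokesRegularity.Theorems.TypeIIInviscidRelaxationAxisymSwirlRegularCoreStrainCriterion
import HarnessLib

/-!
# Crux `OneSidedRadialCriterion` (stmt-NavierStokesRegularity-19059 = piece X₁ of `AxisymSwirlRegular`,
# stmt-NavierStokesRegularity-1964): the piece IS the partial Type I bound for `u_r` in the parabolic core,
# BY NAME — and the crux ⟨1964⟩ in its two research currencies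

`--supports stmt-NavierStokesRegularity-19059` (helper file; theorems only, no definitions, no `sorry`).

The registered line `Cruxes/OneSidedRadialCriterion/Lines/parabolic_core_partial_typeI.lean` localises the
one-sided radial inflow criterion (gate `r u_r ≥ -Cν` on an axis tube, any `C` ⇒ smooth extension) to ONE
research stub: Zhang's partial Type I bound `u_r ≥ -M√ν/√(T-t)` INSIDE the viscous-parabolic core
`0 < r < ξ√(ν(T-t))` near `T` (CPT). Its composition (stub ⇒ crux) is proved in the line file from tree theorems
(`hasSmoothExtensionPast_of_sqrtEnvelope`, `RadialInflowCoreStrain.exists_unitTubeGate_of_tubeGate`); the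
converse was recorded there only in prose ("a solution smooth past `T` has `|u_r| ≤ G r`"). This file puts BOTH
directions in kernel, with the statements taken as `Prop`-valued hypotheses (nothing is closed):

* `CorePartialTypeI.oneSidedRadialCriterion_of_corePartialTypeI` — CPT ⇒ ⟨19059⟩ (the line's cover argument:
  early slab / off-core unit-tube gate / core, rerun here because a `Cruxes/` skeleton is not importable);
* `CorePartialTypeI.exists_bound_of_hasSmoothExtensionPast` — in the standing class a solution that extends
  smoothly past `T` is BOUNDED on `[0,T) × ℝ³` (far field near the top: `axisymmetricL3_boundedNearTop_infinity`;
  near field: continuity of the extension on a compact slab; early slab: `hbd`);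
* `CorePartialTypeI.corePartialTypeI_of_oneSidedRadialCriterion` — ⟨19059⟩ ⇒ CPT (bounded ⇒ `u_r ≥ -‖u‖ ≥ -B`,
  and a constant is below the `√`-envelope with `M = B√T/√ν + 1`);
* `CorePartialTypeI.oneSidedRadialCriterion_iff_corePartialTypeI` — the EQUIVALENCE certificate, by name;
* (in the leaf file `…AxisymSwirlRegularResearchCurrencies.lean`, with
  `aprioriRadialInflowBound_iff_supercriticalDefectFloor`): the crux `AxisymSwirlRegular` ⟨1964⟩ is, BY NAME,
  the conjunction of the two research stubs of the two registered piece lines.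

HONEST FRAMING: EQUIVALENCE / re-typing layer. Both research statements are open (CPT is open exactly for gate
constants `C ≥ 2`, cf. `ScenarioCensus.LogGate.oneSidedRadialCriterion_of_lt_two`); nothing here closes ⟨19059⟩,
⟨19060⟩ or ⟨1964⟩, and nothing about Navier–Stokes regularity is claimed. References: Zhang 2026
(arXiv:2604.07785) Thm 1.1 [Zhang2026PartialTypeI]; KNSS 2009 Thm 5.3 [KochNadirashviliSereginSverak2009].
-/

noncomputable section

open Set Filter Topology Real Metric Function
open Literature.Analysis.FluidPDE
open scoped Laplacian

namespace Summit.NavierStokesRegularity.NavierStokesRegularity.Theorems.CorePartialTypeI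

-- the problem directory repeats the summit name (`NavierStokesRegularity/NavierStokesRegularity`)
set_option linter.dupNamespace false

open Summit.NavierStokesRegularity.NavierStokesRegularity.Theorems
open Summit.NavierStokesRegularity.NavierStokesRegularity.Theorems.RadialInflowCoreStrain
open Summit.NavierStokesRegularity.NavierStokesRegularity.Theses.TypeIIInviscidRelaxation
  (AxisymSwirlRegular OneSidedRadialCriterion AprioriRadialInflowBound)

/-! ### Envelope glue (as in the line file `Lines/parabolic_core_partial_typeI.lean`) -/

/-- Outside the parabolic core the unit-tube gate `-(νΛ₀/r)` dominates the `√`-envelope with constant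
`Λ₀/ξ`: `ξ√(ν(T-t)) ≤ r`, `t < T` ⇒ `-((Λ₀/ξ)·√ν/√(T-t)) ≤ -(νΛ₀/r)`. (Verbatim the line file's
`offCore_envelope`.) [folklore] -/
theorem offCore_envelope {ν Λ₀ ξ T t r : ℝ} (hν : 0 < ν) (hΛ : 0 < Λ₀) (hξ : 0 < ξ) (ht : t < T)
    (hr : ξ * √(ν * (T - t)) ≤ r) :
    -(Λ₀ / ξ * √ν / √(T - t)) ≤ -(ν * Λ₀ / r) := by
  have hs : 0 < T - t := by linarith
  have hsT : 0 < √(T - t) := Real.sqrt_pos.2 hs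
  obtain ⟨a, ha0, rfl⟩ : ∃ a : ℝ, 0 < a ∧ a ^ 2 = ν := ⟨√ν, Real.sqrt_pos.2 hν, Real.sq_sqrt hν.le⟩
  rw [Real.sqrt_sq ha0.le]
  rw [Real.sqrt_mul (by positivity), Real.sqrt_sq ha0.le] at hr
  have hden : 0 < ξ * (a * √(T - t)) := by positivity
  have hr0 : 0 < r := lt_of_lt_of_le hden hr
  suffices h : a ^ 2 * Λ₀ / r ≤ Λ₀ / ξ * a / √(T - t) by linarith
  rw [div_le_div_iff₀ hr0 hsT]
  have h1 : Λ₀ / ξ * a * (ξ * (a * √(T - t))) ≤ Λ₀ / ξ * a * r :=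
    mul_le_mul_of_nonneg_left hr (by positivity)
  have hξ0 : ξ ≠ 0 := hξ.ne'
  have e : Λ₀ / ξ * a * (ξ * (a * √(T - t))) = a ^ 2 * Λ₀ * √(T - t) := by
    field_simp
  linarith

/-- A plain bound `-B ≤ u_r` dominates the `√`-envelope with constant `B√T/√ν + 1` (any `B ≥ 0`; here
`max B 0`): `0 ≤ t < T` ⇒ `-((max B 0 * √T / √ν + 1) * √ν / √(T-t)) ≤ -B`. (Verbatim the line file's
`earlySlab_envelope`, minus its idle hypothesis `0 < T`.) [folklore] -/
theorem earlySlab_envelope {ν B T t : ℝ} (hν : 0 < ν) (ht0 : 0 ≤ t) (ht : t < T) :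
    -((max B 0 * √T / √ν + 1) * √ν / √(T - t)) ≤ -B := by
  have hs : 0 < T - t := by linarith
  have hsq : 0 < √(T - t) := Real.sqrt_pos.2 hs
  have hν' : 0 < √ν := Real.sqrt_pos.2 hν
  have hsT : √(T - t) ≤ √T := Real.sqrt_le_sqrt (by linarith)
  have h2 : B ≤ max B 0 := le_max_left _ _
  have h3 : max B 0 ≤ max B 0 * √T / √ν * √ν / √(T - t) := by
    rw [div_mul_cancel₀ _ hν'.ne', le_div_iff₀ hsq]
    exact mul_le_mul_of_nonneg_left hsT (le_max_right _ _)
  have h4 : max B 0 * √T / √ν * √ν / √(T - t) ≤ (max B 0 * √T / √ν + 1) * √ν / √(T - t) := by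
    apply div_le_div_of_nonneg_right _ hsq.le
    apply mul_le_mul_of_nonneg_right _ hν'.le
    linarith
  linarith

/-- Monotonicity of the envelope in the constant. (Verbatim the line file's `envelope_mono`.) [folklore] -/
theorem envelope_mono {ν T t M M' : ℝ} (hMM : M ≤ M') :
    -(M' * √ν / √(T - t)) ≤ -(M * √ν / √(T - t)) := by
  have h1 : 0 ≤ √ν / √(T - t) := div_nonneg (Real.sqrt_nonneg _) (Real.sqrt_nonneg _)
  have : M * √ν / √(T - t) ≤ M' * √ν / √(T - t) := by
    rw [mul_div_assoc, mul_div_assoc]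
    exact mul_le_mul_of_nonneg_right hMM h1
  linarith

/-! ### CPT ⇒ ⟨19059⟩ (the line's cover argument, with the research stub as a hypothesis) -/

/-- **Partial Type I in the parabolic core ⇒ the one-sided radial inflow criterion, BY NAME.** If every
solution of the standing class carrying the inflow gate obeys `u_r ≥ -M√ν/√(T-t)` inside the parabolic core
`0 < r < ξ√(ν(T-t))` for `t ∈ [T',T)` (CPT, the research stub of the line `parabolic_core_partial_typeI`), then
`OneSidedRadialCriterion` holds: on the early slab `u_r ≥ -‖u‖ ≥ -B`, off the core the unit-tube gate
`u_r ≥ -νΛ₀/r` (`exists_unitTubeGate_of_tubeGate`) dominates the envelope, and Zhang's partial Type I theorem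
(`hasSmoothExtensionPast_of_sqrtEnvelope`) continues the solution. The line file's composition, rerun with the
stub as a hypothesis; nothing is closed. [cite: Zhang2026PartialTypeI, Thm 1.1] -/
theorem oneSidedRadialCriterion_of_corePartialTypeI
    (hCPT : ∀ (ν T : ℝ), 0 < ν → 0 < T →
      ∀ (u : ℝ → EuclideanSpace ℝ (Fin 3) → EuclideanSpace ℝ (Fin 3)) (p : ℝ → EuclideanSpace ℝ (Fin 3) → ℝ),
      IsClassicalNSSolutionOn (Ico 0 T) ν 0 u p → IsLerayHopfOn T ν 0 (u 0) u →
      (∀ T' < T, ∃ M : ℝ, ∀ t ∈ Icc 0 T', ∀ x, ‖u t x‖ ≤ M) →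
      (∀ t ∈ Ico 0 T, IsAxisymmetric (u t)) → HasRapidSpatialDecay (u 0) →
      (∃ C δ : ℝ, 0 < δ ∧ ∀ t ∈ Ico 0 T, ∀ x : EuclideanSpace ℝ (Fin 3), cylRadius x < δ →
        -(C * ν) ≤ x 0 * u t x 0 + x 1 * u t x 1) →
      ∃ ξ M T' : ℝ, 0 < ξ ∧ 0 < M ∧ 0 ≤ T' ∧ T' < T ∧
        ∀ t ∈ Ico T' T, ∀ x : EuclideanSpace ℝ (Fin 3), 0 < cylRadius x → cylRadius x < ξ * √(ν * (T - t)) →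
          -(M * √ν / √(T - t)) ≤ radialVelocity (u t) x) :
    OneSidedRadialCriterion := by
  intro ν T hν hT u p hcl hLH hbd hax hdec hin
  -- (1) research hypothesis: the envelope inside the parabolic core near `T`
  obtain ⟨ξ, M₁, T', hξ, hM₁, hT'0, hT'T, hcore⟩ := hCPT ν T hν hT u p hcl hLH hbd hax hdec hin
  -- (2) tree: the unit-tube gate `u_r ≥ -νΛ₀/r` on `0 < r ≤ 1`, all `t ∈ [0,T)`
  obtain ⟨Λ₀, hΛ₀, hgate⟩ := exists_unitTubeGate_of_tubeGate hν hT hcl hLH hbd hax hdec hin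
  -- (3) the early slab bound
  obtain ⟨B, hB⟩ := hbd T' hT'T
  -- the envelope constant
  set M : ℝ := max M₁ (max (Λ₀ / ξ) (max B 0 * √T / √ν + 1)) with hM_def
  have hM₁M : M₁ ≤ M := le_max_left _ _
  have hΛM : Λ₀ / ξ ≤ M := (le_max_left _ _).trans (le_max_right _ _)
  have hBM : max B 0 * √T / √ν + 1 ≤ M := (le_max_right _ _).trans (le_max_right _ _)
  have hM : 0 < M := lt_of_lt_of_le hM₁ hM₁M
  refine hasSmoothExtensionPast_of_sqrtEnvelope hν hM hT hcl hLH hdec hax ?_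
  intro t ht x hx0 hx1
  by_cases htT' : t ≤ T'
  · -- early slab: `u_r ≥ -‖u‖ ≥ -B`
    have hux : ‖u t x‖ ≤ B := hB t ⟨ht.1, htT'⟩ x
    have h1 : -B ≤ radialVelocity (u t) x :=
      le_trans (by linarith) (Literature.Analysis.FluidPDE.neg_norm_le_radialVelocity (u t) x)
    exact le_trans (le_trans (envelope_mono hBM) (earlySlab_envelope (B := B) hν ht.1 ht.2)) h1
  · push Not at htT'
    have ht' : t ∈ Ico T' T := ⟨htT'.le, ht.2⟩
    by_cases hcr : cylRadius x < ξ * √(ν * (T - t))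
    · -- inside the parabolic core: the research hypothesis
      exact le_trans (envelope_mono hM₁M) (hcore t ht' x hx0 hcr)
    · -- off-core: the unit-tube gate
      push Not at hcr
      exact le_trans (le_trans (envelope_mono hΛM) (offCore_envelope hν hΛ₀ hξ ht.2 hcr))
        (hgate t ht x hx0 hx1)

/-! ### ⟨19059⟩ ⇒ CPT: a solution that extends smoothly past `T` is bounded up to `T` -/

/-- **In the standing class, a smooth extension past `T` makes the solution bounded on `[0,T) × ℝ³`.**
Far field near the top: `axisymmetricL3_boundedNearTop_infinity` (CKN + axisymmetry + Leray–Hopf); near field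
on `[T₁, T] × B̄(0,R)`: continuity of the classical extension on a compact slab; early slab `[0, T₁]`: the
sub-slab bound. [folklore assembly of tree theorems] -/
theorem exists_bound_of_hasSmoothExtensionPast {ν T : ℝ} (hν : 0 < ν) (hT : 0 < T)
    {u : ℝ → EuclideanSpace ℝ (Fin 3) → EuclideanSpace ℝ (Fin 3)} {p : ℝ → EuclideanSpace ℝ (Fin 3) → ℝ}
    (hcl : IsClassicalNSSolutionOn (Ico 0 T) ν 0 u p) (hLH : IsLerayHopfOn T ν 0 (u 0) u)
    (hbd : ∀ T' < T, ∃ M : ℝ, ∀ t ∈ Icc 0 T', ∀ x, ‖u t x‖ ≤ M)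
    (hax : ∀ t ∈ Ico 0 T, IsAxisymmetric (u t))
    (hext : HasSmoothExtensionPast ν 0 u T) :
    ∃ B : ℝ, ∀ t ∈ Ico 0 T, ∀ x, ‖u t x‖ ≤ B := by
  have H : AxisymmetricL3Hyp ν T u p := ⟨hν, hT, hcl, hLH, hbd, hax⟩
  obtain ⟨T'', hTT'', u', p', hcl', hagree⟩ := hext
  -- far field near the top
  obtain ⟨R₀, r₁, K₁, hr₁, hfar⟩ := axisymmetricL3_boundedNearTop_infinity H
  set R : ℝ := max R₀ 0 with hR_def
  set T₁ : ℝ := max (T - r₁ ^ 2 / 2) 0 with hT₁_def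
  have hr₁2 : 0 < r₁ ^ 2 := pow_pos hr₁ 2
  have hT₁0 : 0 ≤ T₁ := le_max_right _ _
  have hT₁T : T₁ < T := max_lt (by linarith) hT
  have hT₁top : T - r₁ ^ 2 < T₁ := lt_of_lt_of_le (by linarith) (le_max_left _ _)
  -- near field: the extension is continuous on the compact slab `[T₁, T] × B̄(0, R)`
  set K : Set (ℝ × EuclideanSpace ℝ (Fin 3)) := Icc T₁ T ×ˢ closedBall (0 : EuclideanSpace ℝ (Fin 3)) R
    with hK_def
  have hK : IsCompact K := isCompact_Icc.prod (isCompact_closedBall _ _)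
  have hKsub : K ⊆ Ico 0 T'' ×ˢ (univ : Set (EuclideanSpace ℝ (Fin 3))) :=
    prod_mono (fun t ht => ⟨hT₁0.trans ht.1, lt_of_le_of_lt ht.2 hTT''⟩) (subset_univ _)
  have hcont : ContinuousOn (uncurry u') K := hcl'.smooth_velocity.continuousOn.mono hKsub
  obtain ⟨K₂, hK₂⟩ := hK.exists_bound_of_continuousOn hcont
  -- early slab
  obtain ⟨B₀, hB₀⟩ := hbd T₁ hT₁T
  refine ⟨max B₀ (max K₁ K₂), fun t ht x => ?_⟩
  by_cases htT₁ : t ≤ T₁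
  · exact (hB₀ t ⟨ht.1, htT₁⟩ x).trans (le_max_left _ _)
  · push Not at htT₁
    have htop : t ∈ Ioo (T - r₁ ^ 2) T := ⟨hT₁top.trans htT₁, ht.2⟩
    by_cases hxR : R ≤ ‖x‖
    · exact (hfar t htop x ((le_max_left _ _).trans hxR)).trans
        ((le_max_left _ _).trans (le_max_right _ _))
    · push Not at hxR
      have hzK : (t, x) ∈ K := ⟨⟨htT₁.le, ht.2.le⟩, mem_closedBall_zero_iff.2 hxR.le⟩
      have heq : u t x = uncurry u' (t, x) := by
        simp only [uncurry_apply_pair, hagree t ht]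
      rw [heq]
      exact (hK₂ _ hzK).trans ((le_max_right _ _).trans (le_max_right _ _))

/-- **A bounded solution satisfies the partial Type I bound in the parabolic core** (indeed on the whole
space, from time `0`, with any core width, here `ξ = 1`): `u_r ≥ -‖u‖ ≥ -B ≥ -(M√ν/√(T-t))`,
`M = max(B,0)√T/√ν + 1`. [folklore] -/
theorem corePartialTypeI_of_bound {ν T B : ℝ} (hν : 0 < ν) (hT : 0 < T)
    {u : ℝ → EuclideanSpace ℝ (Fin 3) → EuclideanSpace ℝ (Fin 3)}
    (hB : ∀ t ∈ Ico 0 T, ∀ x, ‖u t x‖ ≤ B) :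
    ∃ ξ M T' : ℝ, 0 < ξ ∧ 0 < M ∧ 0 ≤ T' ∧ T' < T ∧
      ∀ t ∈ Ico T' T, ∀ x : EuclideanSpace ℝ (Fin 3), 0 < cylRadius x → cylRadius x < ξ * √(ν * (T - t)) →
        -(M * √ν / √(T - t)) ≤ radialVelocity (u t) x := by
  have hMpos : 0 < max B 0 * √T / √ν + 1 := by
    have : 0 ≤ max B 0 * √T / √ν :=
      div_nonneg (mul_nonneg (le_max_right _ _) (Real.sqrt_nonneg _)) (Real.sqrt_nonneg _)
    linarith
  refine ⟨1, max B 0 * √T / √ν + 1, 0, one_pos, hMpos, le_rfl, hT, fun t ht x _ _ => ?_⟩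
  have hux : ‖u t x‖ ≤ B := hB t ht x
  have h1 : -B ≤ radialVelocity (u t) x :=
    le_trans (by linarith) (Literature.Analysis.FluidPDE.neg_norm_le_radialVelocity (u t) x)
  exact le_trans (earlySlab_envelope (B := B) hν ht.1 ht.2) h1

/-- **The one-sided radial inflow criterion ⇒ partial Type I in the parabolic core** (the NECESSITY of the
research stub of the line `parabolic_core_partial_typeI`): under `OneSidedRadialCriterion` a gated solution of
the standing class extends past `T`, hence is bounded on `[0,T) × ℝ³` (`exists_bound_of_hasSmoothExtensionPast`),
hence obeys the core bound (`corePartialTypeI_of_bound`). [folklore] -/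
theorem corePartialTypeI_of_oneSidedRadialCriterion (hX1 : OneSidedRadialCriterion) :
    ∀ (ν T : ℝ), 0 < ν → 0 < T →
      ∀ (u : ℝ → EuclideanSpace ℝ (Fin 3) → EuclideanSpace ℝ (Fin 3)) (p : ℝ → EuclideanSpace ℝ (Fin 3) → ℝ),
      IsClassicalNSSolutionOn (Ico 0 T) ν 0 u p → IsLerayHopfOn T ν 0 (u 0) u →
      (∀ T' < T, ∃ M : ℝ, ∀ t ∈ Icc 0 T', ∀ x, ‖u t x‖ ≤ M) →
      (∀ t ∈ Ico 0 T, IsAxisymmetric (u t)) → HasRapidSpatialDecay (u 0) →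
      (∃ C δ : ℝ, 0 < δ ∧ ∀ t ∈ Ico 0 T, ∀ x : EuclideanSpace ℝ (Fin 3), cylRadius x < δ →
        -(C * ν) ≤ x 0 * u t x 0 + x 1 * u t x 1) →
      ∃ ξ M T' : ℝ, 0 < ξ ∧ 0 < M ∧ 0 ≤ T' ∧ T' < T ∧
        ∀ t ∈ Ico T' T, ∀ x : EuclideanSpace ℝ (Fin 3), 0 < cylRadius x → cylRadius x < ξ * √(ν * (T - t)) →
          -(M * √ν / √(T - t)) ≤ radialVelocity (u t) x := by
  intro ν T hν hT u p hcl hLH hbd hax hdec hin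
  obtain ⟨B, hB⟩ := exists_bound_of_hasSmoothExtensionPast hν hT hcl hLH hbd hax
    (hX1 ν T hν hT u p hcl hLH hbd hax hdec hin)
  exact corePartialTypeI_of_bound hν hT hB

/-- **EQUIVALENCE CERTIFICATE, BY NAME: `OneSidedRadialCriterion ↔` partial Type I for `u_r` in the
parabolic core under the inflow gate.** The research stub of the registered line `parabolic_core_partial_typeI`
carries exactly the strength of the route item ⟨19059⟩. Nothing is closed. [new] -/
theorem oneSidedRadialCriterion_iff_corePartialTypeI :
    OneSidedRadialCriterion ↔
    ∀ (ν T : ℝ), 0 < ν → 0 < T →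
      ∀ (u : ℝ → EuclideanSpace ℝ (Fin 3) → EuclideanSpace ℝ (Fin 3)) (p : ℝ → EuclideanSpace ℝ (Fin 3) → ℝ),
      IsClassicalNSSolutionOn (Ico 0 T) ν 0 u p → IsLerayHopfOn T ν 0 (u 0) u →
      (∀ T' < T, ∃ M : ℝ, ∀ t ∈ Icc 0 T', ∀ x, ‖u t x‖ ≤ M) →
      (∀ t ∈ Ico 0 T, IsAxisymmetric (u t)) → HasRapidSpatialDecay (u 0) →
      (∃ C δ : ℝ, 0 < δ ∧ ∀ t ∈ Ico 0 T, ∀ x : EuclideanSpace ℝ (Fin 3), cylRadius x < δ →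
        -(C * ν) ≤ x 0 * u t x 0 + x 1 * u t x 1) →
      ∃ ξ M T' : ℝ, 0 < ξ ∧ 0 < M ∧ 0 ≤ T' ∧ T' < T ∧
        ∀ t ∈ Ico T' T, ∀ x : EuclideanSpace ℝ (Fin 3), 0 < cylRadius x → cylRadius x < ξ * √(ν * (T - t)) →
          -(M * √ν / √(T - t)) ≤ radialVelocity (u t) x :=
  ⟨corePartialTypeI_of_oneSidedRadialCriterion, oneSidedRadialCriterion_of_corePartialTypeI⟩

/-! ### §2 (appended). The open content of CPT is the regime of gate constants `C ≥ 2`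

Below the critical constant the gate already continues the solution (tree:
`ScenarioCensus.LogGate.oneSidedRadialCriterion_of_lt_two`, Pan 2017 / Zujin Zhang 2018 / Wei 2016 in kernel), hence
bounds it (`exists_bound_of_hasSmoothExtensionPast`), hence gives the core bound (`corePartialTypeI_of_bound`). So the
research stub CPT is equivalent to its restriction to gates with `C ≥ 2`, matching the tree's
`ScenarioCensus.LogGate.oneSidedRadialCriterion_iff_geTwo` for ⟨19059⟩. -/

open Summit.NavierStokesRegularity.NavierStokesRegularity.Theorems.ScenarioCensus.LogGate in
/-- **CPT below the critical constant — PROVED, per solution.** In the standing class a gate `r u_r ≥ -Cν` on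
`{cylRadius < δ} × [0,T)` with `C < 2` yields the partial Type I bound for `u_r` in the parabolic core (indeed a
velocity bound on `[0,T) × ℝ³`). [new; via `oneSidedRadialCriterion_of_lt_two`] -/
theorem corePartialTypeI_of_gate_lt_two {ν T C δ : ℝ} (hν : 0 < ν) (hT : 0 < T) (hC : C < 2) (hδ : 0 < δ)
    {u : ℝ → EuclideanSpace ℝ (Fin 3) → EuclideanSpace ℝ (Fin 3)} {p : ℝ → EuclideanSpace ℝ (Fin 3) → ℝ}
    (hcl : IsClassicalNSSolutionOn (Ico 0 T) ν 0 u p) (hLH : IsLerayHopfOn T ν 0 (u 0) u)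
    (hbd : ∀ T' < T, ∃ M : ℝ, ∀ t ∈ Icc 0 T', ∀ x, ‖u t x‖ ≤ M)
    (hax : ∀ t ∈ Ico 0 T, IsAxisymmetric (u t)) (hdec : HasRapidSpatialDecay (u 0))
    (hin : ∀ t ∈ Ico 0 T, ∀ x : EuclideanSpace ℝ (Fin 3), cylRadius x < δ →
      -(C * ν) ≤ x 0 * u t x 0 + x 1 * u t x 1) :
    ∃ ξ M T' : ℝ, 0 < ξ ∧ 0 < M ∧ 0 ≤ T' ∧ T' < T ∧
      ∀ t ∈ Ico T' T, ∀ x : EuclideanSpace ℝ (Fin 3), 0 < cylRadius x → cylRadius x < ξ * √(ν * (T - t)) →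
        -(M * √ν / √(T - t)) ≤ radialVelocity (u t) x := by
  obtain ⟨B, hB⟩ := exists_bound_of_hasSmoothExtensionPast hν hT hcl hLH hbd hax
    (oneSidedRadialCriterion_of_lt_two hν hT hC hδ hcl hLH hbd hax hdec hin)
  exact corePartialTypeI_of_bound hν hT hB

/-- **CPT ↔ CPT restricted to gates with `C ≥ 2`** (the open regime). [new] -/
theorem corePartialTypeI_iff_geTwo :
    (∀ (ν T : ℝ), 0 < ν → 0 < T →
      ∀ (u : ℝ → EuclideanSpace ℝ (Fin 3) → EuclideanSpace ℝ (Fin 3)) (p : ℝ → EuclideanSpace ℝ (Fin 3) → ℝ),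
      IsClassicalNSSolutionOn (Ico 0 T) ν 0 u p → IsLerayHopfOn T ν 0 (u 0) u →
      (∀ T' < T, ∃ M : ℝ, ∀ t ∈ Icc 0 T', ∀ x, ‖u t x‖ ≤ M) →
      (∀ t ∈ Ico 0 T, IsAxisymmetric (u t)) → HasRapidSpatialDecay (u 0) →
      (∃ C δ : ℝ, 0 < δ ∧ ∀ t ∈ Ico 0 T, ∀ x : EuclideanSpace ℝ (Fin 3), cylRadius x < δ →
        -(C * ν) ≤ x 0 * u t x 0 + x 1 * u t x 1) →
      ∃ ξ M T' : ℝ, 0 < ξ ∧ 0 < M ∧ 0 ≤ T' ∧ T' < T ∧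
        ∀ t ∈ Ico T' T, ∀ x : EuclideanSpace ℝ (Fin 3), 0 < cylRadius x → cylRadius x < ξ * √(ν * (T - t)) →
          -(M * √ν / √(T - t)) ≤ radialVelocity (u t) x) ↔
    (∀ (ν T : ℝ), 0 < ν → 0 < T →
      ∀ (u : ℝ → EuclideanSpace ℝ (Fin 3) → EuclideanSpace ℝ (Fin 3)) (p : ℝ → EuclideanSpace ℝ (Fin 3) → ℝ),
      IsClassicalNSSolutionOn (Ico 0 T) ν 0 u p → IsLerayHopfOn T ν 0 (u 0) u →
      (∀ T' < T, ∃ M : ℝ, ∀ t ∈ Icc 0 T', ∀ x, ‖u t x‖ ≤ M) →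
      (∀ t ∈ Ico 0 T, IsAxisymmetric (u t)) → HasRapidSpatialDecay (u 0) →
      (∃ C δ : ℝ, 2 ≤ C ∧ 0 < δ ∧ ∀ t ∈ Ico 0 T, ∀ x : EuclideanSpace ℝ (Fin 3), cylRadius x < δ →
        -(C * ν) ≤ x 0 * u t x 0 + x 1 * u t x 1) →
      ∃ ξ M T' : ℝ, 0 < ξ ∧ 0 < M ∧ 0 ≤ T' ∧ T' < T ∧
        ∀ t ∈ Ico T' T, ∀ x : EuclideanSpace ℝ (Fin 3), 0 < cylRadius x → cylRadius x < ξ * √(ν * (T - t)) →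
          -(M * √ν / √(T - t)) ≤ radialVelocity (u t) x) := by
  constructor
  · rintro h ν T hν hT u p hcl hLH hbd hax hdec ⟨C, δ, -, hδ, hin⟩
    exact h ν T hν hT u p hcl hLH hbd hax hdec ⟨C, δ, hδ, hin⟩
  · rintro h ν T hν hT u p hcl hLH hbd hax hdec ⟨C, δ, hδ, hin⟩
    rcases lt_or_ge C 2 with hC | hC
    · exact corePartialTypeI_of_gate_lt_two hν hT hC hδ hcl hLH hbd hax hdec hin
    · exact h ν T hν hT u p hcl hLH hbd hax hdec ⟨C, δ, hC, hδ, hin⟩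

open Summit.NavierStokesRegularity.NavierStokesRegularity.Theorems.ScenarioCensus.LogGate in
/-- **BY NAME: `ScenarioCensus.LogGate.OneSidedRadialCriterionGeTwo ↔` CPT restricted to gates with `C ≥ 2`.**
The open `C ≥ 2` half of ⟨19059⟩ in CPT currency. Nothing is closed. [new] -/
theorem oneSidedRadialCriterionGeTwo_iff_corePartialTypeIGeTwo :
    OneSidedRadialCriterionGeTwo ↔
    (∀ (ν T : ℝ), 0 < ν → 0 < T →
      ∀ (u : ℝ → EuclideanSpace ℝ (Fin 3) → EuclideanSpace ℝ (Fin 3)) (p : ℝ → EuclideanSpace ℝ (Fin 3) → ℝ),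
      IsClassicalNSSolutionOn (Ico 0 T) ν 0 u p → IsLerayHopfOn T ν 0 (u 0) u →
      (∀ T' < T, ∃ M : ℝ, ∀ t ∈ Icc 0 T', ∀ x, ‖u t x‖ ≤ M) →
      (∀ t ∈ Ico 0 T, IsAxisymmetric (u t)) → HasRapidSpatialDecay (u 0) →
      (∃ C δ : ℝ, 2 ≤ C ∧ 0 < δ ∧ ∀ t ∈ Ico 0 T, ∀ x : EuclideanSpace ℝ (Fin 3), cylRadius x < δ →
        -(C * ν) ≤ x 0 * u t x 0 + x 1 * u t x 1) →
      ∃ ξ M T' : ℝ, 0 < ξ ∧ 0 < M ∧ 0 ≤ T' ∧ T' < T ∧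
        ∀ t ∈ Ico T' T, ∀ x : EuclideanSpace ℝ (Fin 3), 0 < cylRadius x → cylRadius x < ξ * √(ν * (T - t)) →
          -(M * √ν / √(T - t)) ≤ radialVelocity (u t) x) := by
  rw [← oneSidedRadialCriterion_iff_geTwo, oneSidedRadialCriterion_iff_corePartialTypeI,
    corePartialTypeI_iff_geTwo]

end Summit.NavierStokesRegularity.NavierStokesRegularity.Theorems.CorePartialTypeI

end
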